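import Summits.SmoothPoincare4.SmoothPoincare4.Theses.ConvexBisection

/-!
# SmoothPoincare4 / ConvexBisection — assembly

Settles item stmt-SmoothPoincare4-3549 (assembly of route ConvexBisection, rev 2, unbundled form):
`AcyclicBisectionExists → AcyclicBisectionRigidity → SmoothPoincare4`.

Pure logic: for a Hausdorff second-countable smooth 4-manifold `M` homotopy equivalent to `S⁴`,
`AcyclicBisectionExists` supplies a rationally acyclic Stein bisection of `M` along a common contact
seam, and `AcyclicBisectionRigidity` turns it into a diffeomorphism `M ≃ₘ S⁴`, which is exactly the
shape of the problem statement `SmoothPoincare4`.  Nothing else is used (no named facts).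
-/


namespace Summit.SmoothPoincare4.SmoothPoincare4.Theorems

open Summit.SmoothPoincare4.SmoothPoincare4.Theses.ConvexBisection

/-- Settles stmt-SmoothPoincare4-3549: the assembly
`AcyclicBisectionExists → AcyclicBisectionRigidity → SmoothPoincare4` of route ConvexBisection.
Proof: unfold the three definitions and compose the two hypotheses pointwise in `M`. [folklore] -/
theorem Assembly_proof : Summit.SmoothPoincare4.SmoothPoincare4.Theses.ConvexBisection.Assembly := by
  unfold Assembly
  intro hE hR M _ _ _ _ _ e
  exact hR M e (hE M e)

end Summit.SmoothPoincare4.SmoothPoincare4.Theorems
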